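import Summits.AtomisticToContinuum.Crystallization.Theorems.FrustratedLawDichotomySharpDeficitCap
import Summits.AtomisticToContinuum.Crystallization.Theorems.FrustratedLawDichotomyCellF1cCert

/-!
# FrustratedLawDichotomy · crux `AperiodicFrustratedLawGap` (stmt-AtomisticToContinuum-27623) — «F1Sharp»: THE REACH OF THE CERTIFIED F1 ROW AT THE
# SHARP CAP, UNCONDITIONAL (decomp-a2c hand-2 g49; critic r1892 «F1Sharp corollary GO-on-sight after (407)», r1883 (A))

(407) `…SharpDeficitCap.coherentMassExclusion_sharp` turns certified row floors with margins `≥ m > 0` into the exclusion of every admissible minimising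
law that is `(1 − reach m 5)`-coherent with the atlas (sharp cap `D = 5`, `deficit_le_five`).  #129 `…CellF1cCert.hfloor_KF1c` IS such a floor for the
one-row atlas {F1} — the class-A F1 row of record `KF1c`, margin `mc = 23/10⁴`, NO hypothesis.  Hence, with no hypothesis at all:

* ★★ `coherentMassExclusion_F1_sharp : CoherentMassExclusion 1 (fun _ => KF1c) (reach (23/10⁴) 5)` — no admissible minimising law gives the complement of
  the F1 row mass `< reach (23/10⁴) 5`; ★ `reach_F1c_sharp`: `1/2200 < reach (23/10⁴) 5` (and it is `> 35×` the `D_univ` reach of #129);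
* `coherentMassExclusion_F1_2200 : CoherentMassExclusion 1 (fun _ => KF1c) (1/2200)`;
* `aperiodicFrustratedLawGap_of_offAtlasMassGap_F1_sharp : OffAtlasMassGap 1 (fun _ => KF1c) (reach (23/10⁴) 5) → AperiodicFrustratedLawGap` — the crux ⟸
  its off-{F1} residual at the sharp reach: an admissible minimising law (a counterexample) must put mass `≥ 1/2200` OFF the F1 row.
Imports TREE (407) `…SharpDeficitCap` + #129 `…CellF1cCert`; theorems only; 0 sorry.  Tags: [new: junction instance]; nothing here closes an item.
-/

noncomputable section

namespace Summit.AtomisticToContinuum.Crystallization.Theorems.FrustratedLawDichotomyAtlasReachF1Sharp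

open Summit.AtomisticToContinuum.Crystallization.Theorems.FrustratedLawDichotomyAtlasReach
  (reach Duniv CoherentMassExclusion OffAtlasMassGap coherentMassExclusion_anti aperiodicFrustratedLawGap_of_massSplit)
open Summit.AtomisticToContinuum.Crystallization.Theorems.FrustratedLawDichotomySharpDeficitCap (coherentMassExclusion_sharp)
open Summit.AtomisticToContinuum.Crystallization.Theorems.FrustratedLawDichotomyCellF1cRow (KF1c measurableSet_KF1c)
open Summit.AtomisticToContinuum.Crystallization.Theorems.FrustratedLawDichotomyCellF1cCert (hfloor_KF1c)

/-- ★★ **THE SHARP REACH OF {F1}, UNCONDITIONAL**: no admissible minimising law is `(1 − reach (23/10⁴) 5)`-coherent with the certified F1 row ((407)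
`coherentMassExclusion_sharp` at `n = 1` with `hfloor :=` #129 `hfloor_KF1c`). [new: junction instance] -/
theorem coherentMassExclusion_F1_sharp : CoherentMassExclusion 1 (fun _ => KF1c) (reach (23 / 10000) 5) :=
  coherentMassExclusion_sharp 1 (fun _ => KF1c) (fun _ => measurableSet_KF1c) (fun _ => 23 / 10000) (fun _ _ μ hμ hN hrow => hfloor_KF1c μ hμ hN hrow)
    (by norm_num) (fun _ _ => le_rfl) le_rfl

/-- ★ THE NUMBER: `1/2200 < reach (23/10⁴) 5 < 1/2100`, more than `35×` the `D_univ`-reach of the same row. [new: numerical instance] -/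
theorem reach_F1c_sharp : 1 / 2200 < reach (23 / 10000) 5 ∧ reach (23 / 10000) 5 < 1 / 2100 ∧ 35 * reach (23 / 10000) Duniv < reach (23 / 10000) 5 := by
  unfold reach Duniv
  refine ⟨by norm_num, by norm_num, by norm_num⟩

/-- no admissible minimising law is `(1 − 1/2200)`-coherent with {F1}. [new: numerical instance] -/
theorem coherentMassExclusion_F1_2200 : CoherentMassExclusion 1 (fun _ => KF1c) (1 / 2200) :=
  coherentMassExclusion_anti reach_F1c_sharp.1.le coherentMassExclusion_F1_sharp

/-- ★ the crux ⟸ its off-{F1} residual at the sharp reach: a counterexample law must put mass `≥ reach (23/10⁴) 5 > 1/2200` OFF the F1 row of record.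
[new: junction instance] -/
theorem aperiodicFrustratedLawGap_of_offAtlasMassGap_F1_sharp (hA : OffAtlasMassGap 1 (fun _ => KF1c) (reach (23 / 10000) 5)) :
    Summit.AtomisticToContinuum.Crystallization.Theses.FrustratedLawDichotomy.AperiodicFrustratedLawGap :=
  aperiodicFrustratedLawGap_of_massSplit 1 (fun _ => KF1c) _ coherentMassExclusion_F1_sharp hA

end Summit.AtomisticToContinuum.Crystallization.Theorems.FrustratedLawDichotomyAtlasReachF1Sharp

end
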